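import Summits.QuantumFields.BalabanUV.Beta.GAN24.W3ForcingRate
import Summits.QuantumFields.BalabanUV.Beta.GAN24.T2RecursionAffine

/-!
# `BalabanUV.Beta.GAN24.W3SourceRowsBorder` — ROWS W3-F4a ∕ W3-F4b OF SKELETON-W3 §8.3 AT A GENERIC BORDER TABLE (referee r53
# (w9) ROOT ALIGNMENT): the source of record `b_j` and the forcing `f_m` of the normalised `T2Of` recursion with the border table `B` a
# PARAMETER (shape binder `hB : ∃ C δ, 0 < δ ∧ LocStencil₂ B C δ`), derived from this lineage's base-root theorems `W3SourceRows` ∕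
# `W3ForcingRate` — no re-proof (G-an2-4 formalisation swarm, leaf prover 08, gen 19; journal INTENT «W3-F4AB-BORDER*»; name PROVISIONAL)

NOT IN PRINT; OUR PROOF ATTEMPT (composition of tree theorems).  HONEST FRAMING (cell contract, verbatim): «discharging `BetaPertH` makes
Bałaban's UV stability UNCONDITIONAL — a real constructive-QFT result; it is NOT the continuum limit and NOT the Clay problem.»  HONEST
DEPENDENCY (verbatim): «continuum YM on T⁴ ⇐ BetaPertH ∧ nine spine estimates (0/9 proved); BetaPertH ⇐ (D1) ∧ (D4) ∧ CAP+tail; G-an2-4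
gates asym, D1 and NE2/3/4.»

WHY.  The owner's W3 ENDs (`WSlotT2OfPieces.t2Shape_of_rows` ∕ `t2Drift_of_rows`, staged) hard-code an1's BASE-root border `vh₂S d Lc`;
referee r53 (w9) asks that the border be a PARAMETER of the ENDs with its shape binder `hB` (discharged by `MixedJetTablesPlug.hB_an1` at ANY
box root), exactly as an2's `BalabanStepW2.T2Of_loc` ∕ `WbalT2Of` and leaf-01's F1a∕F1b `T2UnitSplitShapes.…_of_shapes (Bd) (hBff) (hBmm) (hB)`
already do — «the rows' instantiation text changes with the root».  This lineage's F4a∕F4b theorems (`W3SourceRows.source_shape_of_shapes` ∕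
`source_cauchy_of_shapes`, `W3ForcingRate.forcing_locStencil₂_of_shapes`) are stated at `vh₂S d Lc`; here they are moved to a generic border
`B`, i.e. to leaf-04's bracket (`T2RecursionAffine.unitS₂_T2Of_succ_affine`, border implicit) LITERALLY:
`b_B j := fun κ u κ′ u′ ↦ (cE₂·Lc^(2(d+1))) • mmRead Lc (K3OfK K♮_j Lc S♮_j M♮_j (W2SymOfK K♮_j Lc S♮_j M♮_j 0 M₂♮_j)) κ u κ′ u′ + cB • mfNeg (B κ u κ′ u′)`.
HOW.  The base theorems quantify over the free scalars `(cE₂, cB)`: at `cE₂ := (Lc^(2(d+1)))⁻¹`, `cB := 0` they ARE the border-free value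
part (§1); a generic border is then added with `locStencil₂_add'`∕`locStencil₂_smul'`∕`locStencil₂_mfNeg` at the smaller rate (§2); in every
DIFFERENCE the `j`-free border cancels (`W3SourceRows.smul_add_sub_smul_add`), so the Cauchy socket and the forcing hold for an ARBITRARY `B`
with NO hypothesis on it (§2–§3).  §3 states the forcing with leaf-04's `lin4` BY NAME (`T2RecursionAffine` is in the tree; the gen-16 text had
it unfolded — same term by `rfl`), i.e. leaf-01's F1b forcing `f i := (lin4 c₄ K♮_{i+1} Lc T♮_i − lin4 c₄ K♮_i Lc T♮_i) + (b_B (i+1) − b_B i)`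
at a generic tower `x`.  §4 packages the END binders `hb` ∕ `hf` of `shape_of_rows` ∕ `rate_of_rows` VERBATIM at `(B, mom := fun _ ↦ 0)`
(RULINGS-14 (R14-3)) for EVERY admissible input rate `δin ≤ δ*` (referee (w8) RATE HARMONISATION: the plug chooses `δin := min` over the rows).
* §0 `locStencil₂_congr` (pointwise-equal families).
* §1 **`value_shape_of_shapes`**, **`value_cauchy_of_shapes`** — the BORDER-FREE value part: uniform `LocStencil₂` row and geometric Cauchy row.
* §2 **`source_shape_border (hB)`** (ROW W3-F4a at border `B`), **`source_cauchy_border`** (ROW W3-F4b's source socket; `B` arbitrary).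
* §3 **`forcing_locStencil₂_border`** (ROW W3-F4b's `LocStencil₂` conjunct at border `B`, `lin4` by name; CONDITIONAL on the tower shape `hx`
  = «T2Shape», END #1's OUTPUT — ref2 R53-3: a FUNCTION of «T2Shape», order END #1 → F4b → END #2).
* §4 **`hb_border`**, **`hf_border`** — the END texts at `mom := 0`, all `δin ≤ δ*`.
The an1 CENTRED-ROOT instances (`B := vh₂SAt (toSite r) Lc`, `mixFF := mixFFAt (toSite r) Lc`, d = 3, every table binder BY NAME) are the
sequel `GAN24/W3SourceRowsRoot`.

HONEST: [folklore] composition; instantiates NO wall binder by itself, asserts nothing about «T2Shape»∕«T2SupRate» (OPEN, NOT IN PRINT),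
discharges NOTHING of (hW, hWall); the `mom` conjuncts are the TRIVIAL ones of `mom := 0` (no first-moment estimate is claimed); NOT «W-slot
closed», NEVER «G-an2-4 closed», NOT (CONV-C); NOT BetaPertH, NOT continuum, NOT Clay.  0 sorry, 0 cite, 0 `def … : Prop`, 0 def.
-/

noncomputable section

open Literature.MathematicalPhysics.QuantumFieldTheory
open Literature.MathematicalPhysics.QuantumFieldTheory.Balaban1983to89
open Literature.MathematicalPhysics.QuantumFieldTheory.Balaban1983to89.Beta
open ExpKernelCalculus (MKer)
open OneStepResolventKernel (Fib LocStencil)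
open OneStepKernelFamily (KInvStep)
open StepJetData (mfNeg)
open BalabanStepJetsSucc (mmRead wE e3Of)
open BalabanCompositeJets (LocStencil₂)
open SecondOrderResponse (W2SymOfK LocStencilFM)
open BalabanStepW2 (Spure M1 M2Of K3OfK locStencil₂_smul' locStencil₂_add' locStencil₂_mfNeg)
open AveragingMixedJetTables (vh₂S)
open Summit.QuantumFields.BalabanUV.Beta.HessKerDressedUnits (unitK unitS)
open Summit.QuantumFields.BalabanUV.Beta.SecondOrderUnits (unitM unitM₂)
open Summit.QuantumFields.BalabanUV.Beta.GAN24.CombesThomas (sfStep smStep UnitDecayK CauchyDecayK)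
open Summit.QuantumFields.BalabanUV.Beta.GAN24.W3SourceRows (smul_add_sub_smul_add source_shape_of_shapes source_cauchy_of_shapes)
open Summit.QuantumFields.BalabanUV.Beta.GAN24.W3ForcingRate (forcing_locStencil₂_of_shapes)
open Summit.QuantumFields.BalabanUV.Beta.GAN24.T2RecursionAffine (lin4 lin4_apply vsym)

namespace Summit.QuantumFields.BalabanUV.Beta.GAN24.W3SourceRowsBorder

variable {d : ℕ} {Lc : ℕ} [NeZero Lc]

/-! ## §0 Bookkeeping -/

omit [NeZero Lc] in
/-- [folklore] Pointwise-equal bi-stencil families have the same `LocStencil₂` bounds. -/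
theorem locStencil₂_congr {A B : Fin (d + 1) → (Fin (d + 1) → ℤ) → Fin (d + 1) → (Fin (d + 1) → ℤ) → MKer (d + 1) (Fib d)} {C δ : ℝ}
    (hAB : ∀ κ u κ' u', A κ u κ' u' = B κ u κ' u') (h : LocStencil₂ A C δ) : LocStencil₂ B C δ :=
  fun κ u κ' u' => hAB κ u κ' u' ▸ h κ u κ' u'

/-- [folklore] The base theorems' scalar `cE₂·Lc^{2(d+1)}` at `cE₂ := (Lc^{2(d+1)})⁻¹` is `1`. -/
theorem inv_pow_mul_pow : ((Lc : ℝ) ^ (2 * (d + 1)))⁻¹ * (Lc : ℝ) ^ (2 * (d + 1)) = 1 :=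
  inv_mul_cancel₀ (pow_ne_zero _ (Nat.cast_ne_zero.mpr (NeZero.ne Lc)))

/-! ## §1 The border-free value part of the source of record -/

/-- **THE VALUE PART OF THE SOURCE IS `j`-UNIFORMLY `LocStencil₂`** [folklore; generic d] — `W3SourceRows.source_shape_of_shapes` at unit scalar
and zero border: from the K-slot's decay half, «E3Shape» and the mixed binder table's shape with field–field support,
`∃ Cv δv, 0 < δv ∧ ∀ j, LocStencil₂ (fun κ u κ′ u′ ↦ mmRead Lc (K3OfK K♮_j Lc S♮_j M♮_j (W2SymOfK K♮_j Lc S♮_j M♮_j 0 M₂♮_j)) κ u κ′ u′) Cv δv`. -/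
theorem value_shape_of_shapes (hLc : 1 ≤ Lc) {C δ : ℝ} (hK : UnitDecayK d Lc (sfStep Lc) (smStep d Lc) C δ) (hδ : 0 < δ)
    {cE cVH cΛ C₃ δ₃ : ℝ}
    (hE3 : ∀ j : ℕ, LocStencil (unitS (sfStep Lc (j + 1)) (smStep d Lc (j + 1))
      (fun κ u => (cE * wE d Lc (j + 1)) • e3Of d Lc cE cVH cΛ (j + 1) κ u)) C₃ δ₃) (hδ₃ : 0 < δ₃)
    {mixFF : Fin (d + 1) → (Fin (d + 1) → ℤ) → Fin (d + 1) → (Fin (d + 1) → ℤ) → MKer (d + 1) (Fib d)} {CM₂ δ₄ : ℝ}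
    (hmix : LocStencilFM Lc mixFF CM₂ δ₄) (hδ₄ : 0 < δ₄)
    (hfm : ∀ κ u ρ w x z (α μ' : Fin (d + 1)), mixFF κ u ρ w x z (Sum.inl α) (Sum.inr μ') = 0)
    (hm : ∀ κ u ρ w x z (μ' : Fin (d + 1)) (b : Fib d), mixFF κ u ρ w x z (Sum.inr μ') b = 0) :
    ∃ Cv δv : ℝ, 0 < δv ∧ ∀ j, LocStencil₂ (fun κ u κ' u' =>
      mmRead Lc (K3OfK (unitK (sfStep Lc j) (smStep d Lc j) (KInvStep (d := d) Lc j)) Lc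
        (unitS (sfStep Lc j) (smStep d Lc j) (Spure d Lc cE cVH cΛ j)) (unitM (sfStep Lc j) (smStep d Lc j) (M1 d Lc cΛ j))
        (W2SymOfK (unitK (sfStep Lc j) (smStep d Lc j) (KInvStep (d := d) Lc j)) Lc
          (unitS (sfStep Lc j) (smStep d Lc j) (Spure d Lc cE cVH cΛ j)) (unitM (sfStep Lc j) (smStep d Lc j) (M1 d Lc cΛ j)) 0
          (unitM₂ (sfStep Lc j) (smStep d Lc j) (M2Of d Lc mixFF j))) κ u κ' u')) Cv δv := by
  obtain ⟨Cb, δb, hδb, h⟩ := source_shape_of_shapes (d := d) (Lc := Lc) hLc hK hδ hE3 hδ₃ hmix hδ₄ hfm hm (((Lc : ℝ) ^ (2 * (d + 1)))⁻¹) 0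
  refine ⟨Cb, δb, hδb, fun j => locStencil₂_congr (fun κ u κ' u' => ?_) (h j)⟩
  simp only [inv_pow_mul_pow, one_smul, zero_smul, add_zero]

/-- **THE VALUE PART OF THE SOURCE IS CAUCHY AT A GEOMETRIC RATE** [folklore; generic d] — `W3SourceRows.source_cauchy_of_shapes` at unit scalar
and zero border: from the K-slot (`UnitDecayK` ∧ `CauchyDecayK`), «E3Shape» ∧ «E3Drift» and the mixed binder table's shape,
`∃ cv θv δv, 0 ≤ cv ∧ 0 ≤ θv ∧ θv < 1 ∧ 0 < δv ∧ ∀ k j, LocStencil₂ (V_{k+j} − V_k) (cv·θv^k) δv` for the value part `V_j` of `value_shape_of_shapes`. -/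
theorem value_cauchy_of_shapes (hLc : 1 ≤ Lc) {C δ cK θK : ℝ} (hK : UnitDecayK d Lc (sfStep Lc) (smStep d Lc) C δ)
    (hKall : CauchyDecayK d Lc (sfStep Lc) (smStep d Lc) cK θK δ) (hδ : 0 < δ) (hθK0 : 0 ≤ θK) (hθK1 : θK < 1)
    {cE cVH cΛ C₃ c₃ θ₃ δ₃ : ℝ}
    (hE3 : ∀ j : ℕ, LocStencil (unitS (sfStep Lc (j + 1)) (smStep d Lc (j + 1))
      (fun κ u => (cE * wE d Lc (j + 1)) • e3Of d Lc cE cVH cΛ (j + 1) κ u)) C₃ δ₃)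
    (hE3d : ∀ k j : ℕ, LocStencil (fun κ u =>
        unitS (sfStep Lc (k + j + 1)) (smStep d Lc (k + j + 1))
            (fun κ u => (cE * wE d Lc (k + j + 1)) • e3Of d Lc cE cVH cΛ (k + j + 1) κ u) κ u -
          unitS (sfStep Lc (k + 1)) (smStep d Lc (k + 1))
            (fun κ u => (cE * wE d Lc (k + 1)) • e3Of d Lc cE cVH cΛ (k + 1) κ u) κ u) (c₃ * θ₃ ^ k) δ₃)
    (hθ₃ : 0 < θ₃) (hθ₃1 : θ₃ < 1) (hδ₃ : 0 < δ₃)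
    {mixFF : Fin (d + 1) → (Fin (d + 1) → ℤ) → Fin (d + 1) → (Fin (d + 1) → ℤ) → MKer (d + 1) (Fib d)} {CM₂ δ₄ : ℝ}
    (hmix : LocStencilFM Lc mixFF CM₂ δ₄) (hδ₄ : 0 < δ₄)
    (hfm : ∀ κ u ρ w x z (α μ' : Fin (d + 1)), mixFF κ u ρ w x z (Sum.inl α) (Sum.inr μ') = 0)
    (hm : ∀ κ u ρ w x z (μ' : Fin (d + 1)) (b : Fib d), mixFF κ u ρ w x z (Sum.inr μ') b = 0) :
    ∃ cv θv δv : ℝ, 0 ≤ cv ∧ 0 ≤ θv ∧ θv < 1 ∧ 0 < δv ∧ ∀ k j, LocStencil₂ (fun κ u κ' u' =>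
      mmRead Lc (K3OfK (unitK (sfStep Lc (k + j)) (smStep d Lc (k + j)) (KInvStep (d := d) Lc (k + j))) Lc
          (unitS (sfStep Lc (k + j)) (smStep d Lc (k + j)) (Spure d Lc cE cVH cΛ (k + j)))
          (unitM (sfStep Lc (k + j)) (smStep d Lc (k + j)) (M1 d Lc cΛ (k + j)))
          (W2SymOfK (unitK (sfStep Lc (k + j)) (smStep d Lc (k + j)) (KInvStep (d := d) Lc (k + j))) Lc
            (unitS (sfStep Lc (k + j)) (smStep d Lc (k + j)) (Spure d Lc cE cVH cΛ (k + j)))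
            (unitM (sfStep Lc (k + j)) (smStep d Lc (k + j)) (M1 d Lc cΛ (k + j))) 0
            (unitM₂ (sfStep Lc (k + j)) (smStep d Lc (k + j)) (M2Of d Lc mixFF (k + j)))) κ u κ' u')
        - mmRead Lc (K3OfK (unitK (sfStep Lc k) (smStep d Lc k) (KInvStep (d := d) Lc k)) Lc
          (unitS (sfStep Lc k) (smStep d Lc k) (Spure d Lc cE cVH cΛ k)) (unitM (sfStep Lc k) (smStep d Lc k) (M1 d Lc cΛ k))
          (W2SymOfK (unitK (sfStep Lc k) (smStep d Lc k) (KInvStep (d := d) Lc k)) Lc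
            (unitS (sfStep Lc k) (smStep d Lc k) (Spure d Lc cE cVH cΛ k)) (unitM (sfStep Lc k) (smStep d Lc k) (M1 d Lc cΛ k)) 0
            (unitM₂ (sfStep Lc k) (smStep d Lc k) (M2Of d Lc mixFF k))) κ u κ' u')) (cv * θv ^ k) δv := by
  obtain ⟨cb, θb, δb, hcb, hθb0, hθb1, hδb, h⟩ := source_cauchy_of_shapes (d := d) (Lc := Lc) hLc hK hKall hδ hθK0 hθK1 hE3 hE3d hθ₃ hθ₃1
    hδ₃ hmix hδ₄ hfm hm (((Lc : ℝ) ^ (2 * (d + 1)))⁻¹) 0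
  refine ⟨cb, θb, δb, hcb, hθb0, hθb1, hδb, fun k j => locStencil₂_congr (fun κ u κ' u' => ?_) (h k j)⟩
  simp only [inv_pow_mul_pow, one_smul, zero_smul, add_zero]

/-! ## §2 ROW W3-F4a at a generic border; ROW W3-F4b's source socket (the border cancels) -/

/-- **ROW W3-F4a (`LocStencil₂` HALF) AT A GENERIC BORDER TABLE** [folklore composition; generic d].  For every border table `B` with a
`LocStencil₂` shape `hB` (an1's `vh₂SAt (toSite r) Lc` at ANY box root by `MixedJetTablesPlug.hB_an1`; the base root `vh₂S d Lc` by
`T2SlotUnits.locStencil₂_vh₂S`), the K-slot's decay half, «E3Shape» and the mixed binder table's shape give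
`∃ Cb δb, 0 < δb ∧ ∀ j, LocStencil₂ (b_B j) Cb δb` for leaf-04's bracket `b_B j` at border `B` (module docstring): §1's value part ⊕ the border
at the smaller rate. -/
theorem source_shape_border (hLc : 1 ≤ Lc) {C δ : ℝ} (hK : UnitDecayK d Lc (sfStep Lc) (smStep d Lc) C δ) (hδ : 0 < δ)
    {cE cVH cΛ C₃ δ₃ : ℝ}
    (hE3 : ∀ j : ℕ, LocStencil (unitS (sfStep Lc (j + 1)) (smStep d Lc (j + 1))
      (fun κ u => (cE * wE d Lc (j + 1)) • e3Of d Lc cE cVH cΛ (j + 1) κ u)) C₃ δ₃) (hδ₃ : 0 < δ₃)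
    {mixFF : Fin (d + 1) → (Fin (d + 1) → ℤ) → Fin (d + 1) → (Fin (d + 1) → ℤ) → MKer (d + 1) (Fib d)} {CM₂ δ₄ : ℝ}
    (hmix : LocStencilFM Lc mixFF CM₂ δ₄) (hδ₄ : 0 < δ₄)
    (hfm : ∀ κ u ρ w x z (α μ' : Fin (d + 1)), mixFF κ u ρ w x z (Sum.inl α) (Sum.inr μ') = 0)
    (hm : ∀ κ u ρ w x z (μ' : Fin (d + 1)) (b : Fib d), mixFF κ u ρ w x z (Sum.inr μ') b = 0)
    {B : Fin (d + 1) → (Fin (d + 1) → ℤ) → Fin (d + 1) → (Fin (d + 1) → ℤ) → MKer (d + 1) (Fib d)}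
    (hB : ∃ C δ : ℝ, 0 < δ ∧ LocStencil₂ B C δ) (cE₂ cB : ℝ) :
    ∃ Cb δb : ℝ, 0 < δb ∧ ∀ j, LocStencil₂ (fun κ u κ' u' =>
      (cE₂ * (Lc : ℝ) ^ (2 * (d + 1))) •
          mmRead Lc (K3OfK (unitK (sfStep Lc j) (smStep d Lc j) (KInvStep (d := d) Lc j)) Lc
            (unitS (sfStep Lc j) (smStep d Lc j) (Spure d Lc cE cVH cΛ j)) (unitM (sfStep Lc j) (smStep d Lc j) (M1 d Lc cΛ j))
            (W2SymOfK (unitK (sfStep Lc j) (smStep d Lc j) (KInvStep (d := d) Lc j)) Lc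
              (unitS (sfStep Lc j) (smStep d Lc j) (Spure d Lc cE cVH cΛ j)) (unitM (sfStep Lc j) (smStep d Lc j) (M1 d Lc cΛ j)) 0
              (unitM₂ (sfStep Lc j) (smStep d Lc j) (M2Of d Lc mixFF j))) κ u κ' u')
        + cB • mfNeg (B κ u κ' u')) Cb δb := by
  obtain ⟨Cv, δv, hδv, hV⟩ := value_shape_of_shapes (d := d) (Lc := Lc) hLc hK hδ hE3 hδ₃ hmix hδ₄ hfm hm
  obtain ⟨CB, δB, hδB, hB⟩ := hB
  refine ⟨|cE₂ * (Lc : ℝ) ^ (2 * (d + 1))| * Cv + |cB| * CB, min δv δB, lt_min hδv hδB, fun j => ?_⟩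
  exact locStencil₂_add' (locStencil₂_smul' _ ((hV j).mono (min_le_left _ _)))
    (locStencil₂_smul' cB (locStencil₂_mfNeg (hB.mono (min_le_right _ _))))

/-- **ROW W3-F4b (SOURCE-DIFFERENCE SOCKET) AT AN ARBITRARY BORDER TABLE** [folklore composition; generic d].  The `j`-free border summand
`cB • mfNeg ∘ B` CANCELS in `b_B (k+j) − b_B k` (`W3SourceRows.smul_add_sub_smul_add`), so `W3SourceRows.source_cauchy_of_shapes` holds for EVERY
`B`, with NO hypothesis on it: `∃ cb θb δb, 0 ≤ cb ∧ 0 ≤ θb ∧ θb < 1 ∧ 0 < δb ∧ ∀ k j, LocStencil₂ (b_B (k+j) − b_B k) (cb·θb^k) δb` — the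
difference written at `Pi` level, as in leaf-01's F1b forcing text. -/
theorem source_cauchy_border (hLc : 1 ≤ Lc) {C δ cK θK : ℝ} (hK : UnitDecayK d Lc (sfStep Lc) (smStep d Lc) C δ)
    (hKall : CauchyDecayK d Lc (sfStep Lc) (smStep d Lc) cK θK δ) (hδ : 0 < δ) (hθK0 : 0 ≤ θK) (hθK1 : θK < 1)
    {cE cVH cΛ C₃ c₃ θ₃ δ₃ : ℝ}
    (hE3 : ∀ j : ℕ, LocStencil (unitS (sfStep Lc (j + 1)) (smStep d Lc (j + 1))
      (fun κ u => (cE * wE d Lc (j + 1)) • e3Of d Lc cE cVH cΛ (j + 1) κ u)) C₃ δ₃)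
    (hE3d : ∀ k j : ℕ, LocStencil (fun κ u =>
        unitS (sfStep Lc (k + j + 1)) (smStep d Lc (k + j + 1))
            (fun κ u => (cE * wE d Lc (k + j + 1)) • e3Of d Lc cE cVH cΛ (k + j + 1) κ u) κ u -
          unitS (sfStep Lc (k + 1)) (smStep d Lc (k + 1))
            (fun κ u => (cE * wE d Lc (k + 1)) • e3Of d Lc cE cVH cΛ (k + 1) κ u) κ u) (c₃ * θ₃ ^ k) δ₃)
    (hθ₃ : 0 < θ₃) (hθ₃1 : θ₃ < 1) (hδ₃ : 0 < δ₃)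
    {mixFF : Fin (d + 1) → (Fin (d + 1) → ℤ) → Fin (d + 1) → (Fin (d + 1) → ℤ) → MKer (d + 1) (Fib d)} {CM₂ δ₄ : ℝ}
    (hmix : LocStencilFM Lc mixFF CM₂ δ₄) (hδ₄ : 0 < δ₄)
    (hfm : ∀ κ u ρ w x z (α μ' : Fin (d + 1)), mixFF κ u ρ w x z (Sum.inl α) (Sum.inr μ') = 0)
    (hm : ∀ κ u ρ w x z (μ' : Fin (d + 1)) (b : Fib d), mixFF κ u ρ w x z (Sum.inr μ') b = 0)
    (B : Fin (d + 1) → (Fin (d + 1) → ℤ) → Fin (d + 1) → (Fin (d + 1) → ℤ) → MKer (d + 1) (Fib d)) (cE₂ cB : ℝ) :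
    ∃ cb θb δb : ℝ, 0 ≤ cb ∧ 0 ≤ θb ∧ θb < 1 ∧ 0 < δb ∧ ∀ k j, LocStencil₂
      ((fun κ u κ' u' => (cE₂ * (Lc : ℝ) ^ (2 * (d + 1))) •
          mmRead Lc (K3OfK (unitK (sfStep Lc (k + j)) (smStep d Lc (k + j)) (KInvStep (d := d) Lc (k + j))) Lc
            (unitS (sfStep Lc (k + j)) (smStep d Lc (k + j)) (Spure d Lc cE cVH cΛ (k + j)))
            (unitM (sfStep Lc (k + j)) (smStep d Lc (k + j)) (M1 d Lc cΛ (k + j)))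
            (W2SymOfK (unitK (sfStep Lc (k + j)) (smStep d Lc (k + j)) (KInvStep (d := d) Lc (k + j))) Lc
              (unitS (sfStep Lc (k + j)) (smStep d Lc (k + j)) (Spure d Lc cE cVH cΛ (k + j)))
              (unitM (sfStep Lc (k + j)) (smStep d Lc (k + j)) (M1 d Lc cΛ (k + j))) 0
              (unitM₂ (sfStep Lc (k + j)) (smStep d Lc (k + j)) (M2Of d Lc mixFF (k + j)))) κ u κ' u')
        + cB • mfNeg (B κ u κ' u'))
      - (fun κ u κ' u' => (cE₂ * (Lc : ℝ) ^ (2 * (d + 1))) •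
          mmRead Lc (K3OfK (unitK (sfStep Lc k) (smStep d Lc k) (KInvStep (d := d) Lc k)) Lc
            (unitS (sfStep Lc k) (smStep d Lc k) (Spure d Lc cE cVH cΛ k)) (unitM (sfStep Lc k) (smStep d Lc k) (M1 d Lc cΛ k))
            (W2SymOfK (unitK (sfStep Lc k) (smStep d Lc k) (KInvStep (d := d) Lc k)) Lc
              (unitS (sfStep Lc k) (smStep d Lc k) (Spure d Lc cE cVH cΛ k)) (unitM (sfStep Lc k) (smStep d Lc k) (M1 d Lc cΛ k)) 0
              (unitM₂ (sfStep Lc k) (smStep d Lc k) (M2Of d Lc mixFF k))) κ u κ' u')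
        + cB • mfNeg (B κ u κ' u')))
      (cb * θb ^ k) δb := by
  obtain ⟨cb, θb, δb, hcb, hθb0, hθb1, hδb, h⟩ := source_cauchy_of_shapes (d := d) (Lc := Lc) hLc hK hKall hδ hθK0 hθK1 hE3 hE3d hθ₃ hθ₃1
    hδ₃ hmix hδ₄ hfm hm cE₂ cB
  refine ⟨cb, θb, δb, hcb, hθb0, hθb1, hδb, fun k j => locStencil₂_congr (fun κ u κ' u' => ?_) (h k j)⟩
  simp only [Pi.sub_apply, smul_add_sub_smul_add]

/-! ## §3 ROW W3-F4b's `LocStencil₂` conjunct at a generic border, `lin4` by name -/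

/-- **ROW W3-F4b (`LocStencil₂` HALF) AT A GENERIC BORDER TABLE, AS A FUNCTION OF THE TOWER's UNIFORM SHAPE** [folklore composition; generic
d].  For every family `x` with `∀ j, LocStencil₂ (x j) C₂ δ₂` (`hx`; for an2's tower «T2Shape» = END #1's output) and EVERY border table `B`
(no hypothesis: it cancels), the forcing of leaf-01's difference recursion written with leaf-04's `lin4` BY NAME,
`f m := (lin4 c₄ K♮_{m+1} Lc (x m) − lin4 c₄ K♮_m Lc (x m)) + (b_B (m+1) − b_B m)`, `c₄ = cE₂·Lc^{2(d+1)}`, is `LocStencil₂` with a GEOMETRIC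
constant `cf·θf^m` at one rate — `W3ForcingRate.forcing_locStencil₂_of_shapes` (its unfolded `lin4` is this one by `rfl`; the base border is
exchanged for `B` by the cancellation). -/
theorem forcing_locStencil₂_border (hLc : 1 ≤ Lc) {C δ cK θK : ℝ} (hK : UnitDecayK d Lc (sfStep Lc) (smStep d Lc) C δ)
    (hKall : CauchyDecayK d Lc (sfStep Lc) (smStep d Lc) cK θK δ) (hδ : 0 < δ) (hθK0 : 0 ≤ θK) (hθK1 : θK < 1)
    {cE cVH cΛ C₃ c₃ θ₃ δ₃ : ℝ}
    (hE3 : ∀ j : ℕ, LocStencil (unitS (sfStep Lc (j + 1)) (smStep d Lc (j + 1))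
      (fun κ u => (cE * wE d Lc (j + 1)) • e3Of d Lc cE cVH cΛ (j + 1) κ u)) C₃ δ₃)
    (hE3d : ∀ k j : ℕ, LocStencil (fun κ u =>
        unitS (sfStep Lc (k + j + 1)) (smStep d Lc (k + j + 1))
            (fun κ u => (cE * wE d Lc (k + j + 1)) • e3Of d Lc cE cVH cΛ (k + j + 1) κ u) κ u -
          unitS (sfStep Lc (k + 1)) (smStep d Lc (k + 1))
            (fun κ u => (cE * wE d Lc (k + 1)) • e3Of d Lc cE cVH cΛ (k + 1) κ u) κ u) (c₃ * θ₃ ^ k) δ₃)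
    (hθ₃ : 0 < θ₃) (hθ₃1 : θ₃ < 1) (hδ₃ : 0 < δ₃)
    {mixFF : Fin (d + 1) → (Fin (d + 1) → ℤ) → Fin (d + 1) → (Fin (d + 1) → ℤ) → MKer (d + 1) (Fib d)} {CM₂ δ₄ : ℝ}
    (hmix : LocStencilFM Lc mixFF CM₂ δ₄) (hδ₄ : 0 < δ₄)
    (hfm : ∀ κ u ρ w x z (α μ' : Fin (d + 1)), mixFF κ u ρ w x z (Sum.inl α) (Sum.inr μ') = 0)
    (hm : ∀ κ u ρ w x z (μ' : Fin (d + 1)) (b : Fib d), mixFF κ u ρ w x z (Sum.inr μ') b = 0)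
    (B : Fin (d + 1) → (Fin (d + 1) → ℤ) → Fin (d + 1) → (Fin (d + 1) → ℤ) → MKer (d + 1) (Fib d)) (cE₂ cB : ℝ)
    {x : ℕ → Fin (d + 1) → (Fin (d + 1) → ℤ) → Fin (d + 1) → (Fin (d + 1) → ℤ) → MKer (d + 1) (Fib d)} {C₂ δ₂ : ℝ}
    (hx : ∀ j, LocStencil₂ (x j) C₂ δ₂) (hδ₂ : 0 < δ₂) :
    ∃ cf θf δf : ℝ, 0 ≤ cf ∧ 0 ≤ θf ∧ θf < 1 ∧ 0 < δf ∧ ∀ m, LocStencil₂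
      ((lin4 (cE₂ * (Lc : ℝ) ^ (2 * (d + 1))) (unitK (sfStep Lc (m + 1)) (smStep d Lc (m + 1)) (KInvStep (d := d) Lc (m + 1))) Lc (x m)
          - lin4 (cE₂ * (Lc : ℝ) ^ (2 * (d + 1))) (unitK (sfStep Lc m) (smStep d Lc m) (KInvStep (d := d) Lc m)) Lc (x m))
        + ((fun κ u κ' u' => (cE₂ * (Lc : ℝ) ^ (2 * (d + 1))) •
            mmRead Lc (K3OfK (unitK (sfStep Lc (m + 1)) (smStep d Lc (m + 1)) (KInvStep (d := d) Lc (m + 1))) Lc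
              (unitS (sfStep Lc (m + 1)) (smStep d Lc (m + 1)) (Spure d Lc cE cVH cΛ (m + 1)))
              (unitM (sfStep Lc (m + 1)) (smStep d Lc (m + 1)) (M1 d Lc cΛ (m + 1)))
              (W2SymOfK (unitK (sfStep Lc (m + 1)) (smStep d Lc (m + 1)) (KInvStep (d := d) Lc (m + 1))) Lc
                (unitS (sfStep Lc (m + 1)) (smStep d Lc (m + 1)) (Spure d Lc cE cVH cΛ (m + 1)))
                (unitM (sfStep Lc (m + 1)) (smStep d Lc (m + 1)) (M1 d Lc cΛ (m + 1))) 0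
                (unitM₂ (sfStep Lc (m + 1)) (smStep d Lc (m + 1)) (M2Of d Lc mixFF (m + 1)))) κ u κ' u')
            + cB • mfNeg (B κ u κ' u'))
          - (fun κ u κ' u' => (cE₂ * (Lc : ℝ) ^ (2 * (d + 1))) •
            mmRead Lc (K3OfK (unitK (sfStep Lc m) (smStep d Lc m) (KInvStep (d := d) Lc m)) Lc
              (unitS (sfStep Lc m) (smStep d Lc m) (Spure d Lc cE cVH cΛ m)) (unitM (sfStep Lc m) (smStep d Lc m) (M1 d Lc cΛ m))
              (W2SymOfK (unitK (sfStep Lc m) (smStep d Lc m) (KInvStep (d := d) Lc m)) Lc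
                (unitS (sfStep Lc m) (smStep d Lc m) (Spure d Lc cE cVH cΛ m)) (unitM (sfStep Lc m) (smStep d Lc m) (M1 d Lc cΛ m)) 0
                (unitM₂ (sfStep Lc m) (smStep d Lc m) (M2Of d Lc mixFF m))) κ u κ' u')
            + cB • mfNeg (B κ u κ' u'))))
      (cf * θf ^ m) δf := by
  obtain ⟨cf, θf, δf, hcf, hθf0, hθf1, hδf, h⟩ := forcing_locStencil₂_of_shapes (d := d) (Lc := Lc) hLc hK hKall hδ hθK0 hθK1 hE3 hE3d
    hθ₃ hθ₃1 hδ₃ hmix hδ₄ hfm hm cE₂ cB hx hδ₂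
  refine ⟨cf, θf, δf, hcf, hθf0, hθf1, hδf, fun m => locStencil₂_congr (fun κ u κ' u' => ?_) (h m)⟩
  simp only [Pi.add_apply, Pi.sub_apply, smul_add_sub_smul_add, lin4_apply, vsym]

/-! ## §4 The END binders `hb` ∕ `hf` VERBATIM at `(B, mom := 0)`, for every admissible input rate (referee (w8)) -/

/-- **ROW W3-F4a IN THE END's BINDER SHAPE, `mom := 0`, EVERY INPUT RATE `δin ≤ δ*`** [folklore packaging; generic d]: for the border `B` of
`source_shape_border`, `∃ Cb δ*, 0 ≤ Cb ∧ 0 < δ* ∧ ∀ δin ≤ δ*, ∀ m, LocStencil₂ (b_B m) Cb δin ∧ 0 ≤ Cb` — the `hb` of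
`WSlotT2OfPieces.shape_of_rows` ∕ `t2Shape_of_rows` at `(b := b_B, mom := fun _ ↦ 0)` (RULINGS-14 (R14-3); the second conjunct is `mom (b m) ≤ Cb`
by `rfl`), at whatever common `δin` the plug chooses (`LocStencil₂.mono`). -/
theorem hb_border (hLc : 1 ≤ Lc) {C δ : ℝ} (hK : UnitDecayK d Lc (sfStep Lc) (smStep d Lc) C δ) (hδ : 0 < δ)
    {cE cVH cΛ C₃ δ₃ : ℝ}
    (hE3 : ∀ j : ℕ, LocStencil (unitS (sfStep Lc (j + 1)) (smStep d Lc (j + 1))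
      (fun κ u => (cE * wE d Lc (j + 1)) • e3Of d Lc cE cVH cΛ (j + 1) κ u)) C₃ δ₃) (hδ₃ : 0 < δ₃)
    {mixFF : Fin (d + 1) → (Fin (d + 1) → ℤ) → Fin (d + 1) → (Fin (d + 1) → ℤ) → MKer (d + 1) (Fib d)} {CM₂ δ₄ : ℝ}
    (hmix : LocStencilFM Lc mixFF CM₂ δ₄) (hδ₄ : 0 < δ₄)
    (hfm : ∀ κ u ρ w x z (α μ' : Fin (d + 1)), mixFF κ u ρ w x z (Sum.inl α) (Sum.inr μ') = 0)
    (hm : ∀ κ u ρ w x z (μ' : Fin (d + 1)) (b : Fib d), mixFF κ u ρ w x z (Sum.inr μ') b = 0)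
    {B : Fin (d + 1) → (Fin (d + 1) → ℤ) → Fin (d + 1) → (Fin (d + 1) → ℤ) → MKer (d + 1) (Fib d)}
    (hB : ∃ C δ : ℝ, 0 < δ ∧ LocStencil₂ B C δ) (cE₂ cB : ℝ) :
    ∃ Cb δb : ℝ, 0 ≤ Cb ∧ 0 < δb ∧ ∀ ⦃δin : ℝ⦄, δin ≤ δb → ∀ m, LocStencil₂ (fun κ u κ' u' =>
      (cE₂ * (Lc : ℝ) ^ (2 * (d + 1))) •
          mmRead Lc (K3OfK (unitK (sfStep Lc m) (smStep d Lc m) (KInvStep (d := d) Lc m)) Lc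
            (unitS (sfStep Lc m) (smStep d Lc m) (Spure d Lc cE cVH cΛ m)) (unitM (sfStep Lc m) (smStep d Lc m) (M1 d Lc cΛ m))
            (W2SymOfK (unitK (sfStep Lc m) (smStep d Lc m) (KInvStep (d := d) Lc m)) Lc
              (unitS (sfStep Lc m) (smStep d Lc m) (Spure d Lc cE cVH cΛ m)) (unitM (sfStep Lc m) (smStep d Lc m) (M1 d Lc cΛ m)) 0
              (unitM₂ (sfStep Lc m) (smStep d Lc m) (M2Of d Lc mixFF m))) κ u κ' u')
        + cB • mfNeg (B κ u κ' u')) Cb δin ∧ 0 ≤ Cb := by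
  obtain ⟨Cb, δb, hδb, h⟩ := source_shape_border (d := d) (Lc := Lc) hLc hK hδ hE3 hδ₃ hmix hδ₄ hfm hm hB cE₂ cB
  have hCb : 0 ≤ Cb := (h 0).nonneg
  exact ⟨Cb, δb, hCb, hδb, fun δin hin m => ⟨(h m).mono hin, hCb⟩⟩

/-- **ROW W3-F4b IN THE END's BINDER SHAPE, `mom := 0`, EVERY INPUT RATE `δin ≤ δ*`, AS A FUNCTION OF THE TOWER's UNIFORM SHAPE** [folklore
packaging; generic d]: for EVERY border `B` and every tower `x` with `hx`, `∃ Cf θ δ*, 0 ≤ Cf ∧ 0 ≤ θ ∧ θ < 1 ∧ 0 < δ* ∧ ∀ δin ≤ δ*, ∀ m,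
LocStencil₂ (f m) (Cf·θ^m) δin ∧ 0 ≤ Cf·θ^m` — the `hf` of `WSlotT2OfPieces.rate_of_rows` ∕ `t2Drift_of_rows` at `(f := f_B, mom := fun _ ↦ 0)` with
the forcing of `forcing_locStencil₂_border` (CONDITIONAL on `hx` = «T2Shape», END #1's output; ref2 R53-3). -/
theorem hf_border (hLc : 1 ≤ Lc) {C δ cK θK : ℝ} (hK : UnitDecayK d Lc (sfStep Lc) (smStep d Lc) C δ)
    (hKall : CauchyDecayK d Lc (sfStep Lc) (smStep d Lc) cK θK δ) (hδ : 0 < δ) (hθK0 : 0 ≤ θK) (hθK1 : θK < 1)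
    {cE cVH cΛ C₃ c₃ θ₃ δ₃ : ℝ}
    (hE3 : ∀ j : ℕ, LocStencil (unitS (sfStep Lc (j + 1)) (smStep d Lc (j + 1))
      (fun κ u => (cE * wE d Lc (j + 1)) • e3Of d Lc cE cVH cΛ (j + 1) κ u)) C₃ δ₃)
    (hE3d : ∀ k j : ℕ, LocStencil (fun κ u =>
        unitS (sfStep Lc (k + j + 1)) (smStep d Lc (k + j + 1))
            (fun κ u => (cE * wE d Lc (k + j + 1)) • e3Of d Lc cE cVH cΛ (k + j + 1) κ u) κ u -
          unitS (sfStep Lc (k + 1)) (smStep d Lc (k + 1))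
            (fun κ u => (cE * wE d Lc (k + 1)) • e3Of d Lc cE cVH cΛ (k + 1) κ u) κ u) (c₃ * θ₃ ^ k) δ₃)
    (hθ₃ : 0 < θ₃) (hθ₃1 : θ₃ < 1) (hδ₃ : 0 < δ₃)
    {mixFF : Fin (d + 1) → (Fin (d + 1) → ℤ) → Fin (d + 1) → (Fin (d + 1) → ℤ) → MKer (d + 1) (Fib d)} {CM₂ δ₄ : ℝ}
    (hmix : LocStencilFM Lc mixFF CM₂ δ₄) (hδ₄ : 0 < δ₄)
    (hfm : ∀ κ u ρ w x z (α μ' : Fin (d + 1)), mixFF κ u ρ w x z (Sum.inl α) (Sum.inr μ') = 0)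
    (hm : ∀ κ u ρ w x z (μ' : Fin (d + 1)) (b : Fib d), mixFF κ u ρ w x z (Sum.inr μ') b = 0)
    (B : Fin (d + 1) → (Fin (d + 1) → ℤ) → Fin (d + 1) → (Fin (d + 1) → ℤ) → MKer (d + 1) (Fib d)) (cE₂ cB : ℝ)
    {x : ℕ → Fin (d + 1) → (Fin (d + 1) → ℤ) → Fin (d + 1) → (Fin (d + 1) → ℤ) → MKer (d + 1) (Fib d)} {C₂ δ₂ : ℝ}
    (hx : ∀ j, LocStencil₂ (x j) C₂ δ₂) (hδ₂ : 0 < δ₂) :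
    ∃ Cf θ δf : ℝ, 0 ≤ Cf ∧ 0 ≤ θ ∧ θ < 1 ∧ 0 < δf ∧ ∀ ⦃δin : ℝ⦄, δin ≤ δf → ∀ m, LocStencil₂
      ((lin4 (cE₂ * (Lc : ℝ) ^ (2 * (d + 1))) (unitK (sfStep Lc (m + 1)) (smStep d Lc (m + 1)) (KInvStep (d := d) Lc (m + 1))) Lc (x m)
          - lin4 (cE₂ * (Lc : ℝ) ^ (2 * (d + 1))) (unitK (sfStep Lc m) (smStep d Lc m) (KInvStep (d := d) Lc m)) Lc (x m))
        + ((fun κ u κ' u' => (cE₂ * (Lc : ℝ) ^ (2 * (d + 1))) •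
            mmRead Lc (K3OfK (unitK (sfStep Lc (m + 1)) (smStep d Lc (m + 1)) (KInvStep (d := d) Lc (m + 1))) Lc
              (unitS (sfStep Lc (m + 1)) (smStep d Lc (m + 1)) (Spure d Lc cE cVH cΛ (m + 1)))
              (unitM (sfStep Lc (m + 1)) (smStep d Lc (m + 1)) (M1 d Lc cΛ (m + 1)))
              (W2SymOfK (unitK (sfStep Lc (m + 1)) (smStep d Lc (m + 1)) (KInvStep (d := d) Lc (m + 1))) Lc
                (unitS (sfStep Lc (m + 1)) (smStep d Lc (m + 1)) (Spure d Lc cE cVH cΛ (m + 1)))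
                (unitM (sfStep Lc (m + 1)) (smStep d Lc (m + 1)) (M1 d Lc cΛ (m + 1))) 0
                (unitM₂ (sfStep Lc (m + 1)) (smStep d Lc (m + 1)) (M2Of d Lc mixFF (m + 1)))) κ u κ' u')
            + cB • mfNeg (B κ u κ' u'))
          - (fun κ u κ' u' => (cE₂ * (Lc : ℝ) ^ (2 * (d + 1))) •
            mmRead Lc (K3OfK (unitK (sfStep Lc m) (smStep d Lc m) (KInvStep (d := d) Lc m)) Lc
              (unitS (sfStep Lc m) (smStep d Lc m) (Spure d Lc cE cVH cΛ m)) (unitM (sfStep Lc m) (smStep d Lc m) (M1 d Lc cΛ m))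
              (W2SymOfK (unitK (sfStep Lc m) (smStep d Lc m) (KInvStep (d := d) Lc m)) Lc
                (unitS (sfStep Lc m) (smStep d Lc m) (Spure d Lc cE cVH cΛ m)) (unitM (sfStep Lc m) (smStep d Lc m) (M1 d Lc cΛ m)) 0
                (unitM₂ (sfStep Lc m) (smStep d Lc m) (M2Of d Lc mixFF m))) κ u κ' u')
            + cB • mfNeg (B κ u κ' u'))))
      (Cf * θ ^ m) δin ∧ 0 ≤ Cf * θ ^ m := by
  obtain ⟨cf, θf, δf, hcf, hθf0, hθf1, hδf, h⟩ := forcing_locStencil₂_border (d := d) (Lc := Lc) hLc hK hKall hδ hθK0 hθK1 hE3 hE3d hθ₃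
    hθ₃1 hδ₃ hmix hδ₄ hfm hm B cE₂ cB hx hδ₂
  exact ⟨cf, θf, δf, hcf, hθf0, hθf1, hδf, fun δin hin m => ⟨(h m).mono hin, by positivity⟩⟩

end Summit.QuantumFields.BalabanUV.Beta.GAN24.W3SourceRowsBorder

end
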